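import Mathlib.LinearAlgebra.Matrix.SchurComplement
import Mathlib.LinearAlgebra.Matrix.Transvection
import Mathlib.LinearAlgebra.Matrix.GeneralLinearGroup.Defs
import Mathlib.RingTheory.LocalRing.Basic
import Mathlib.RingTheory.LocalRing.MaximalIdeal.Basic
import Mathlib.Data.Fintype.Option
import Literature.NumberTheory.Automorphic.UnitaryGroupFormTransport
import HarnessLib

/-!
# Unimodular hermitian matrices over a local ring with involution are all congruent (Jacobowitz, unramified case)

Topic `NumberTheory/QuadraticForms`; namespace `Literature.NumberTheory.QuadraticForms.HermitianUnimodular`.  KERNEL ONLY: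
theorems, no definition, no named fact, no `sorry`; pure commutative algebra.

**Setting.** `R` a commutative LOCAL ring with a ring involution `σ` (`σ ∘ σ = id`) such that
* (trace) some `b ∈ R` has `b + σ b = 1` (e.g. `b = ½` when `2 ∈ Rˣ`; in general: the trace `R → R^σ` is onto), and
* (norm) every `σ`-fixed unit is a norm: `σ u = u`, `u ∈ Rˣ ⇒ ∃ t, t · σ t = u`.
These are exactly the two properties of the valuation ring `R = 𝒪_w` of an UNRAMIFIED quadratic extension `E_w/F_v` of
non-archimedean local fields with `σ` the Galois involution (trace and norm are surjective onto `𝒪_v`, resp. `𝒪_vˣ`;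
[Serre1979, Ch. V §2 Prop. 3 and Cor.]), which is how the cell `hodgecm-mathlib` consumes the file (hyperspecial unitary
groups at inert places).  A matrix `H ∈ M_ι(R)` is `σ`-HERMITIAN when `(σH)ᵀ = H` and UNIMODULAR when `det H ∈ Rˣ`; the
congruence action of `T ∈ GL_ι(R)` is the tree's `formCongr σ T H = (σT)ᵀ H T` (`Automorphic/UnitaryGroupFormTransport.lean`).

**Results** ([Jacobowitz1962, §7, Thm. 7.1 ∕ §4.8 for unramified `E/F`: a unimodular hermitian lattice over the valuation ring of
an unramified quadratic extension has an orthonormal basis, so is determined by its rank]; the proof is the Gram–Schmidt induction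
of [Jacobowitz1962, §4] written with block matrices):
* `exists_isUnit_formCongr_diag` — a unimodular hermitian matrix on a non-empty index set is congruent to one with a UNIT diagonal
  entry (if all diagonal entries lie in the maximal ideal, some off-diagonal `H i j` is a unit, and the transvection
  `eᵢ ↦ eᵢ + a eⱼ` with `a · H i j = b` makes the `(i,i)` entry `≡ 1`);
* `exists_formCongr_eq_one` — **every unimodular `σ`-hermitian `H ∈ M_ι(R)` is congruent to `1`**: `∃ T : GL ι R, (σT)ᵀ H T = 1`
  (induction on the index type via `Fintype.induction_empty_option`: move the unit pivot to the last index, split it off by the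
  Schur-complement transvection, normalise it by (norm), recurse);
* `exists_formCongr_eq` — hence ANY TWO unimodular `σ`-hermitian matrices of the same size are `GL_ι(R)`-congruent (e.g. to the
  antidiagonal form `antidiag(1, …, 1)` of the quasi-split unitary group).

## References
* [Jacobowitz1962] R. Jacobowitz, *Hermitian forms over local fields*, Amer. J. Math. 84 (1962) 441–465, §4 and §7 (unramified
  dyadic), Thm. 7.1.
* [Serre1979] J.-P. Serre, *Local Fields*, GTM 67, Ch. V §2 (norm and trace in unramified extensions).
-/

set_option autoImplicit false

namespace Literature.NumberTheory.QuadraticForms.HermitianUnimodular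

open Matrix Literature.NumberTheory.Automorphic

universe u

variable {R : Type*} [CommRing R] (σ : R →+* R)

/-! ## §1 Congruence bookkeeping over any commutative ring -/

section General

variable {ι : Type*} [Fintype ι] [DecidableEq ι]

/-- `formCongr σ 1 H = H`. [folklore] -/
private theorem formCongr_one (H : Matrix ι ι R) : formCongr σ (1 : GL ι R) H = H := by
  simp [formCongr, Matrix.map_one σ (map_zero σ) (map_one σ)]

/-- congruence is an action: `(σ(ST))ᵀ H (ST) = σ(T)ᵀ ((σS)ᵀ H S) T`. [folklore] -/
private theorem formCongr_mul (S T : GL ι R) (H : Matrix ι ι R) :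
    formCongr σ (S * T) H = formCongr σ T (formCongr σ S H) := by
  simp only [formCongr, Units.val_mul, Matrix.map_mul, Matrix.transpose_mul, Matrix.mul_assoc]

/-- congruence preserves unimodularity. [folklore] -/
private theorem isUnit_det_formCongr (T : GL ι R) {H : Matrix ι ι R} (hH : IsUnit H.det) :
    IsUnit (formCongr σ T H).det := by
  have hT : IsUnit (T : Matrix ι ι R).det := (Matrix.isUnit_iff_isUnit_det _).1 (Units.isUnit T)
  simp only [formCongr, Matrix.det_mul, Matrix.det_transpose]
  refine (IsUnit.mul ?_ hH).mul hT
  rw [← RingHom.mapMatrix_apply, ← RingHom.map_det]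
  exact hT.map σ

/-- congruence preserves `σ`-hermitian matrices (`σ` an involution). [folklore] -/
private theorem formCongr_hermitian (hσ : ∀ x, σ (σ x) = x) (T : GL ι R) {H : Matrix ι ι R} (hH : (H.map σ)ᵀ = H) :
    ((formCongr σ T H).map σ)ᵀ = formCongr σ T H := by
  have hTT : ((T : Matrix ι ι R).map σ).map σ = (T : Matrix ι ι R) := by
    rw [Matrix.map_map]
    exact Matrix.ext fun i j => hσ _
  simp only [formCongr, Matrix.map_mul, Matrix.transpose_mul, Matrix.transpose_map, Matrix.transpose_transpose, hTT,
    Matrix.mul_assoc]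
  rw [← Matrix.transpose_map, hH]

/-- undoing a congruence: `(σT)ᵀ H T = H'` gives `(σT⁻¹)ᵀ H' T⁻¹ = H`. [folklore] -/
private theorem formCongr_inv_of_eq {T : GL ι R} {H H' : Matrix ι ι R} (h : formCongr σ T H = H') :
    formCongr σ T⁻¹ H' = H := by
  rw [← h, ← formCongr_mul, mul_inv_cancel, formCongr_one]

omit [Fintype ι] [DecidableEq ι] in
/-- `σ` fixes the inverse of a `σ`-fixed unit. [folklore] -/
private theorem map_units_inv_of_map_eq {d : Rˣ} (h : σ d = d) : σ (↑d⁻¹ : R) = ↑d⁻¹ :=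
  Units.eq_inv_of_mul_eq_one_left (by rw [← h, ← map_mul]; simp)

variable {κ : Type*} [Fintype κ] [DecidableEq κ]

/-- **reindexing**: if `H` reindexed along `e : κ ≃ ι` is congruent to `1`, so is `H`. [folklore] -/
private theorem exists_formCongr_eq_one_of_submatrix (e : κ ≃ ι) (H : Matrix ι ι R)
    (h : ∃ T : GL κ R, formCongr σ T (H.submatrix e e) = 1) : ∃ T : GL ι R, formCongr σ T H = 1 := by
  obtain ⟨T, hT⟩ := h
  -- the reindexed `GL`-matrix `T.submatrix e⁻¹ e⁻¹`
  refine ⟨⟨(T : Matrix κ κ R).submatrix e.symm e.symm, ((T⁻¹ : GL κ R) : Matrix κ κ R).submatrix e.symm e.symm,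
    by rw [Matrix.submatrix_mul_equiv, ← Units.val_mul, mul_inv_cancel, Units.val_one, Matrix.submatrix_one_equiv],
    by rw [Matrix.submatrix_mul_equiv, ← Units.val_mul, inv_mul_cancel, Units.val_one, Matrix.submatrix_one_equiv]⟩, ?_⟩
  have hH : H = (H.submatrix e e).submatrix e.symm e.symm := by
    rw [Matrix.submatrix_submatrix, Equiv.self_comp_symm, Matrix.submatrix_id_id]
  change (((T : Matrix κ κ R).submatrix e.symm e.symm).map σ)ᵀ * H * (T : Matrix κ κ R).submatrix e.symm e.symm = 1
  conv_lhs => rw [hH]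
  rw [← Matrix.submatrix_map, Matrix.transpose_submatrix, Matrix.submatrix_mul_equiv, Matrix.submatrix_mul_equiv]
  change (formCongr σ T (H.submatrix e e)).submatrix e.symm e.symm = 1
  rw [hT, Matrix.submatrix_one_equiv]

end General

/-! ## §2 The unit pivot (local ring, trace hypothesis) -/

section Pivot

variable {ι : Type*} [Fintype ι] [DecidableEq ι]

/-- over a LOCAL ring, a unimodular matrix on a non-empty index set has a UNIT entry (else `det H` lies in the maximal ideal).
[folklore] -/
private theorem exists_isUnit_entry [IsLocalRing R] [Nonempty ι] (H : Matrix ι ι R) (hdet : IsUnit H.det) :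
    ∃ i j, IsUnit (H i j) := by
  by_contra h
  push Not at h
  have hmem : ∀ i j, H i j ∈ IsLocalRing.maximalIdeal R := fun i j => (IsLocalRing.mem_maximalIdeal _).2 (h i j)
  apply (IsLocalRing.mem_maximalIdeal _).1 _ hdet
  rw [Matrix.det_apply']
  refine Ideal.sum_mem _ fun τ _ => Ideal.mul_mem_left _ _ ?_
  obtain ⟨i₀⟩ := ‹Nonempty ι›
  rw [← Finset.mul_prod_erase _ _ (Finset.mem_univ i₀)]
  exact Ideal.mul_mem_right _ _ (hmem _ _)

/-- **the unit pivot** [Jacobowitz1962, §4 (4.2)–(4.4)]: a unimodular `σ`-hermitian matrix over a local ring with the trace property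
is congruent to a matrix with a unit DIAGONAL entry — either some `H i i` is already a unit, or all of them lie in the maximal
ideal, some `H i j` (`i ≠ j`) is a unit, and for `a := b · (H i j)⁻¹` (`b + σ b = 1`) the transvection `T = 1 + a e_{ji}` gives
`((σT)ᵀ H T) i i = H i i + (b + σ b) + a σ(a) H j j ≡ 1`. [cite: Jacobowitz1962, §4 (4.2)–(4.4)] -/
theorem exists_isUnit_formCongr_diag [IsLocalRing R] [Nonempty ι] (htr : ∃ b : R, b + σ b = 1)
    (H : Matrix ι ι R) (hH : (H.map σ)ᵀ = H) (hdet : IsUnit H.det) :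
    ∃ (E : GL ι R) (p : ι), IsUnit (formCongr σ E H p p) := by
  by_cases hdiag : ∃ p, IsUnit (H p p)
  · obtain ⟨p, hp⟩ := hdiag
    exact ⟨1, p, by rwa [formCongr_one]⟩
  push Not at hdiag
  obtain ⟨i, j, hij⟩ := exists_isUnit_entry H hdet
  have hne : i ≠ j := by
    rintro rfl
    exact hdiag i hij
  obtain ⟨b, hb⟩ := htr
  -- the transvection `e_i ↦ e_i + a e_j`, `a = b / H i j`
  set a : R := b * ↑hij.unit⁻¹ with ha
  have haH : H i j * a = b := by
    rw [ha, mul_left_comm, IsUnit.mul_val_inv, mul_one]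
  have hji : H j i = σ (H i j) := by
    conv_lhs => rw [← hH]
    rw [Matrix.transpose_apply, Matrix.map_apply]
  have hdetE : IsUnit (Matrix.transvection j i a).det := by
    rw [Matrix.det_transvection_of_ne j i hne.symm a]
    exact isUnit_one
  set E : GL ι R := ((Matrix.isUnit_iff_isUnit_det _).2 hdetE).unit with hE
  refine ⟨E, i, ?_⟩
  have hEval : (E : Matrix ι ι R) = 1 + Matrix.single j i a := by
    rw [hE, IsUnit.unit_spec, Matrix.transvection]
  have hmapS : (Matrix.single j i a).map σ = Matrix.single j i (σ a) := by
    ext k l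
    simp only [Matrix.map_apply, Matrix.single, Matrix.of_apply]
    split_ifs <;> simp
  have hEσ : ((E : Matrix ι ι R).map σ)ᵀ = 1 + Matrix.single i j (σ a) := by
    rw [hEval, Matrix.map_add σ (map_add σ), Matrix.map_one σ (map_zero σ) (map_one σ), hmapS, Matrix.transpose_add,
      Matrix.transpose_one, Matrix.transpose_single]
  have h2 : σ a * σ (H i j) = σ b := by rw [← map_mul, mul_comm, haH]
  have hentry : formCongr σ E H i i = H i i + (b + σ b) + a * σ a * H j j := by
    rw [formCongr, hEσ, hEval]
    simp only [Matrix.add_mul, Matrix.mul_add, Matrix.one_mul, Matrix.mul_one, Matrix.add_apply,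
      Matrix.single_mul_apply_same, Matrix.mul_single_apply_same, hji]
    linear_combination haH + h2
  rw [hentry, hb]
  -- `H i i`, `H j j` lie in the maximal ideal, so the entry is `1 +` a non-unit
  have hm : H i i + a * σ a * H j j ∈ IsLocalRing.maximalIdeal R :=
    Ideal.add_mem _ ((IsLocalRing.mem_maximalIdeal _).2 (hdiag i)) (Ideal.mul_mem_left _ _ ((IsLocalRing.mem_maximalIdeal _).2 (hdiag j)))
  have h1 : H i i + 1 + a * σ a * H j j = 1 + (H i i + a * σ a * H j j) := by ring
  rw [h1]
  by_contra hnu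
  have hmem1 : (1 : R) + (H i i + a * σ a * H j j) ∈ IsLocalRing.maximalIdeal R := (IsLocalRing.mem_maximalIdeal _).2 hnu
  have : (1 : R) ∈ IsLocalRing.maximalIdeal R := by
    have := Ideal.sub_mem _ hmem1 hm
    rwa [add_sub_cancel_right] at this
  exact (IsLocalRing.maximalIdeal.isMaximal R).ne_top (Ideal.eq_top_of_isUnit_mem _ this isUnit_one)

end Pivot

/-! ## §3 Splitting off a unit pivot at the last index (Schur complement) -/

section Schur

variable {α : Type*} [Fintype α] [DecidableEq α]

/-- a `1 × 1` matrix is the scalar matrix of its entry. [folklore] -/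
private theorem punit_eq_smul_one (D : Matrix PUnit.{u+1} PUnit.{u+1} R) : D = (D PUnit.unit PUnit.unit) • (1 : Matrix _ _ R) := by
  ext ⟨⟩ ⟨⟩
  simp

/-- **the Schur-complement step** [Jacobowitz1962, §4 (4.3)]: a `σ`-hermitian block matrix `(A B; C D)` on `α ⊕ pt` whose corner
`D = (d)` is a unit is congruent, by the transvection `L = (1 0; d⁻¹C 1)`, to `diag(A - d⁻¹ B C, D)`:
`(σL)ᵀ · diag(A - d⁻¹BC, D) · L = (A B; C D)`. [cite: Jacobowitz1962, §4 (4.3)] -/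
private theorem formCongr_fromBlocks_schur (A : Matrix α α R) (B : Matrix α PUnit.{u+1} R)
    (C : Matrix PUnit.{u+1} α R) (D : Matrix PUnit.{u+1} PUnit.{u+1} R) (hCB : (C.map σ)ᵀ = B)
    (hD : σ (D PUnit.unit PUnit.unit) = D PUnit.unit PUnit.unit) (d : Rˣ) (hd : (d : R) = D PUnit.unit PUnit.unit)
    (L : GL (α ⊕ PUnit.{u+1}) R)
    (hL : (L : Matrix (α ⊕ PUnit.{u+1}) (α ⊕ PUnit.{u+1}) R) = Matrix.fromBlocks 1 0 ((↑d⁻¹ : R) • C) 1) :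
    formCongr σ L (Matrix.fromBlocks (A - (↑d⁻¹ : R) • (B * C)) 0 0 D) = Matrix.fromBlocks A B C D := by
  have hσd : σ (↑d⁻¹ : R) = ↑d⁻¹ := map_units_inv_of_map_eq σ (by rw [hd]; exact hD)
  have hmapC : ((↑d⁻¹ : R) • C).map σ = (↑d⁻¹ : R) • C.map σ := by
    ext k l
    simp only [Matrix.map_apply, Matrix.smul_apply, smul_eq_mul, map_mul, hσd]
  have hDs : D = (d : R) • (1 : Matrix PUnit.{u+1} PUnit.{u+1} R) := by rw [hd]; exact punit_eq_smul_one D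
  have hBD : B * D = (d : R) • B := by rw [hDs, Matrix.mul_smul, Matrix.mul_one]
  have hDC : D * C = (d : R) • C := by rw [hDs, Matrix.smul_mul, Matrix.one_mul]
  simp only [formCongr, hL, Matrix.fromBlocks_map, Matrix.fromBlocks_transpose, Matrix.map_one σ (map_zero σ) (map_one σ),
    Matrix.map_zero σ (map_zero σ), Matrix.transpose_one, Matrix.transpose_zero, hmapC, Matrix.transpose_smul, hCB,
    Matrix.fromBlocks_multiply, Matrix.one_mul, Matrix.mul_one, Matrix.zero_mul, Matrix.mul_zero, add_zero, zero_add,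
    Matrix.smul_mul, Matrix.mul_smul, hBD, hDC, smul_smul, Units.inv_mul, one_smul]
  congr 1
  rw [sub_add_cancel]

end Schur

/-! ## §4 Every unimodular hermitian matrix is congruent to `1` -/

section Main

/-- the induction step: from an index type `α` to `α ⊕ pt`. [cite: Jacobowitz1962, §4 (4.2)–(4.4) and §7] -/
private theorem step [IsLocalRing R] (hσ : ∀ x, σ (σ x) = x) (htr : ∃ b : R, b + σ b = 1)
    (hnorm : ∀ u : R, IsUnit u → σ u = u → ∃ t : R, t * σ t = u)
    {α : Type u} [Fintype α] [DecidableEq α]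
    (ih : ∀ S : Matrix α α R, (S.map σ)ᵀ = S → IsUnit S.det → ∃ T : GL α R, formCongr σ T S = 1)
    (H : Matrix (α ⊕ PUnit.{u+1}) (α ⊕ PUnit.{u+1}) R) (hH : (H.map σ)ᵀ = H) (hdet : IsUnit H.det) :
    ∃ T : GL (α ⊕ PUnit.{u+1}) R, formCongr σ T H = 1 := by
  -- (1) a unit pivot, moved to the last index
  obtain ⟨E, p, hp⟩ := exists_isUnit_formCongr_diag σ htr H hH hdet
  set H₁ := formCongr σ E H with hH₁def
  have hH₁ : (H₁.map σ)ᵀ = H₁ := formCongr_hermitian σ hσ E hH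
  have hdet₁ : IsUnit H₁.det := isUnit_det_formCongr σ E hdet
  set s : α ⊕ PUnit.{u+1} ≃ α ⊕ PUnit.{u+1} := Equiv.swap p (Sum.inr PUnit.unit) with hs
  set H₂ := H₁.submatrix s s with hH₂def
  have hH₂ : (H₂.map σ)ᵀ = H₂ := by
    rw [hH₂def, ← Matrix.submatrix_map, Matrix.transpose_submatrix, hH₁]
  have hdet₂ : IsUnit H₂.det := by rwa [hH₂def, Matrix.det_submatrix_equiv_self]
  have hpiv : IsUnit (H₂ (Sum.inr PUnit.unit) (Sum.inr PUnit.unit)) := by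
    rw [hH₂def, Matrix.submatrix_apply, hs, Equiv.swap_apply_right]
    exact hp
  -- suffices: `H₂` is congruent to `1`
  suffices h₂ : ∃ T : GL (α ⊕ PUnit.{u+1}) R, formCongr σ T H₂ = 1 by
    obtain ⟨T₁, hT₁⟩ := exists_formCongr_eq_one_of_submatrix σ s H₁ h₂
    exact ⟨E * T₁, by rw [formCongr_mul, hT₁]⟩
  -- (2) blocks and the Schur complement
  set A := H₂.toBlocks₁₁
  set B := H₂.toBlocks₁₂
  set C := H₂.toBlocks₂₁
  set D := H₂.toBlocks₂₂
  have hblocks : Matrix.fromBlocks A B C D = H₂ := Matrix.fromBlocks_toBlocks H₂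
  have hherm := hH₂
  rw [← hblocks, Matrix.fromBlocks_map, Matrix.fromBlocks_transpose, Matrix.fromBlocks_inj] at hherm
  obtain ⟨hA, hCB, hBC, hDD⟩ := hherm
  have hDu : IsUnit (D PUnit.unit PUnit.unit) := hpiv
  set d : Rˣ := hDu.unit with hd
  have hdval : (d : R) = D PUnit.unit PUnit.unit := hDu.unit_spec
  have hσD : σ (D PUnit.unit PUnit.unit) = D PUnit.unit PUnit.unit := by
    have h := congrFun (congrFun hDD PUnit.unit) PUnit.unit
    rwa [Matrix.transpose_apply, Matrix.map_apply] at h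
  -- the transvection `L` and its inverse
  have hdetL : IsUnit (Matrix.fromBlocks (1 : Matrix α α R) 0 ((↑d⁻¹ : R) • C) (1 : Matrix PUnit.{u+1} PUnit.{u+1} R)).det := by
    rw [Matrix.det_fromBlocks_zero₁₂, Matrix.det_one, Matrix.det_one, one_mul]
    exact isUnit_one
  set L : GL (α ⊕ PUnit.{u+1}) R := ((Matrix.isUnit_iff_isUnit_det _).2 hdetL).unit with hLdef
  have hL : (L : Matrix (α ⊕ PUnit.{u+1}) (α ⊕ PUnit.{u+1}) R) = Matrix.fromBlocks 1 0 ((↑d⁻¹ : R) • C) 1 := by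
    rw [hLdef, IsUnit.unit_spec]
  set S := A - (↑d⁻¹ : R) • (B * C) with hSdef
  have hschur : formCongr σ L (Matrix.fromBlocks S 0 0 D) = H₂ := by
    rw [← hblocks]
    exact formCongr_fromBlocks_schur σ A B C D hCB hσD d hdval L hL
  have hdiag : formCongr σ L⁻¹ H₂ = Matrix.fromBlocks S 0 0 D := formCongr_inv_of_eq σ hschur
  -- (3) the complement `S` is hermitian unimodular: induction hypothesis; normalise the pivot by a norm
  have hSD : ((Matrix.fromBlocks S 0 0 D).map σ)ᵀ = Matrix.fromBlocks S 0 0 D := by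
    rw [← hdiag]; exact formCongr_hermitian σ hσ L⁻¹ hH₂
  rw [Matrix.fromBlocks_map, Matrix.fromBlocks_transpose, Matrix.fromBlocks_inj] at hSD
  have hS : (S.map σ)ᵀ = S := hSD.1
  have hdetSD : IsUnit (Matrix.fromBlocks S 0 0 D).det := by
    rw [← hdiag]; exact isUnit_det_formCongr σ L⁻¹ hdet₂
  rw [Matrix.det_fromBlocks_zero₁₂] at hdetSD
  obtain ⟨TS, hTS⟩ := ih S hS (isUnit_of_mul_isUnit_left hdetSD)
  obtain ⟨t, ht⟩ := hnorm (↑d⁻¹ : R) (Units.isUnit _) (map_units_inv_of_map_eq σ (by rw [hdval]; exact hσD))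
  have htu : IsUnit t := isUnit_of_mul_isUnit_left (by rw [ht]; exact Units.isUnit _)
  -- the block-diagonal normalisation `diag(TS, t)`
  have hdetN : IsUnit (Matrix.fromBlocks (TS : Matrix α α R) 0 0 (t • (1 : Matrix PUnit.{u+1} PUnit.{u+1} R))).det := by
    rw [Matrix.det_fromBlocks_zero₁₂, Matrix.det_smul, Matrix.det_one, mul_one, Fintype.card_punit, pow_one]
    exact ((Matrix.isUnit_iff_isUnit_det _).1 (Units.isUnit TS)).mul htu
  set Nm : GL (α ⊕ PUnit.{u+1}) R := ((Matrix.isUnit_iff_isUnit_det _).2 hdetN).unit with hNmdef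
  have hNm : (Nm : Matrix (α ⊕ PUnit.{u+1}) (α ⊕ PUnit.{u+1}) R) = Matrix.fromBlocks (TS : Matrix α α R) 0 0 (t • 1) := by
    rw [hNmdef, IsUnit.unit_spec]
  have hfin : formCongr σ Nm (Matrix.fromBlocks S 0 0 D) = 1 := by
    have hTS' : ((TS : Matrix α α R).map σ)ᵀ * S * (TS : Matrix α α R) = 1 := hTS
    have hDt : σ t * D PUnit.unit PUnit.unit * t = 1 := by
      rw [← hdval, mul_comm (σ t), mul_assoc, mul_comm (σ t), ht, Units.mul_inv]
    rw [formCongr, hNm, Matrix.fromBlocks_map, Matrix.fromBlocks_transpose]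
    simp only [Matrix.map_zero σ (map_zero σ), Matrix.transpose_zero, Matrix.fromBlocks_multiply, Matrix.mul_zero, Matrix.zero_mul,
      add_zero, zero_add, hTS']
    rw [← Matrix.fromBlocks_one]
    congr 1
    ext ⟨⟩ ⟨⟩
    simp only [Matrix.mul_apply, Matrix.transpose_apply, Matrix.map_apply, Matrix.smul_apply, Matrix.one_apply_eq, smul_eq_mul,
      mul_one, Finset.univ_unique, Finset.sum_singleton]
    linear_combination hDt
  exact ⟨L⁻¹ * Nm, by rw [formCongr_mul, hdiag, hfin]⟩

/-- **Every unimodular `σ`-hermitian matrix over a local ring with involution satisfying (trace) and (norm) is congruent to the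
identity**: `∃ T ∈ GL_ι(R), (σT)ᵀ H T = 1` — i.e. a unimodular hermitian lattice has an ORTHONORMAL basis [Jacobowitz1962, §7
Thm. 7.1 (unramified case) with §4 (4.2)–(4.4)].  Induction on the (finite) index type: unit pivot (`exists_isUnit_formCongr_diag`),
Schur-complement splitting, normalisation of the pivot by a norm `t σ(t) = d⁻¹`. [cite: Jacobowitz1962, §7 Thm. 7.1] -/
theorem exists_formCongr_eq_one [IsLocalRing R] (hσ : ∀ x, σ (σ x) = x) (htr : ∃ b : R, b + σ b = 1)
    (hnorm : ∀ u : R, IsUnit u → σ u = u → ∃ t : R, t * σ t = u)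
    {ι : Type u} [Fintype ι] [DecidableEq ι] (H : Matrix ι ι R) (hH : (H.map σ)ᵀ = H) (hdet : IsUnit H.det) :
    ∃ T : GL ι R, formCongr σ T H = 1 := by
  revert hH hdet H
  refine Fintype.induction_empty_option
    (P := fun (ι : Type u) _ => ∀ [DecidableEq ι] (H : Matrix ι ι R), (H.map σ)ᵀ = H → IsUnit H.det →
      ∃ T : GL ι R, formCongr σ T H = 1) ?_ ?_ ?_ ι
  · -- invariance under equivalence of index types
    intro α β _ e h _ H hH hdet
    letI : Fintype α := Fintype.ofEquiv β e.symm
    classical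
    refine exists_formCongr_eq_one_of_submatrix σ e H (h (H.submatrix e e) ?_ ?_)
    · rw [← Matrix.submatrix_map, Matrix.transpose_submatrix, hH]
    · rwa [Matrix.det_submatrix_equiv_self]
  · -- the empty index type
    intro _ H _ _
    exact ⟨1, Subsingleton.elim _ _⟩
  · -- `Option α ≃ α ⊕ pt`
    intro α _ ih _ H hH hdet
    classical
    refine exists_formCongr_eq_one_of_submatrix σ (Equiv.optionEquivSumPUnit.{u, u} α).symm H ?_
    exact step σ hσ htr hnorm (fun S hS hSdet => ih S hS hSdet) _
      (by rw [← Matrix.submatrix_map, Matrix.transpose_submatrix, hH]) (by rwa [Matrix.det_submatrix_equiv_self])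

/-- **Any two unimodular `σ`-hermitian matrices of the same size are congruent** over such a ring: `∃ T ∈ GL_ι(R), (σT)ᵀ H' T = H`
— a unimodular hermitian lattice over the valuation ring of an unramified quadratic extension is determined by its rank
[Jacobowitz1962, §7 Thm. 7.1]; in particular every such `H` is congruent to the antidiagonal form `antidiag(1, …, 1)`.
[cite: Jacobowitz1962, §7 Thm. 7.1] -/
theorem exists_formCongr_eq [IsLocalRing R] (hσ : ∀ x, σ (σ x) = x) (htr : ∃ b : R, b + σ b = 1)
    (hnorm : ∀ u : R, IsUnit u → σ u = u → ∃ t : R, t * σ t = u)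
    {ι : Type u} [Fintype ι] [DecidableEq ι] (H H' : Matrix ι ι R) (hH : (H.map σ)ᵀ = H) (hdet : IsUnit H.det)
    (hH' : (H'.map σ)ᵀ = H') (hdet' : IsUnit H'.det) :
    ∃ T : GL ι R, formCongr σ T H' = H := by
  obtain ⟨T, hT⟩ := exists_formCongr_eq_one σ hσ htr hnorm H hH hdet
  obtain ⟨T', hT'⟩ := exists_formCongr_eq_one σ hσ htr hnorm H' hH' hdet'
  exact ⟨T' * T⁻¹, by rw [formCongr_mul, hT', formCongr_inv_of_eq σ hT]⟩

end Main

end Literature.NumberTheory.QuadraticForms.HermitianUnimodular
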